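import Mathlib
import Summits.NavierStokesRegularity.NavierStokesRegularity.Theorems.FilamentSkeletonRssSkeletonJ1GSplit
import Summits.NavierStokesRegularity.NavierStokesRegularity.Theorems.FilamentSkeletonRssClause13RAdjointEnergy

/-!
# Sketch — crux idea `perpendicular-datum-coercivity` (crux `SkeletonJ1R`, stmt-NavierStokesRegularity-23610)

First checkable statements of the line (ideator k=2, round 1).  Nothing here is a route item; `sorry`-free.

LEVER.  For the linearised in-ball normal transport `Y ↦ w•Y′ − S⊥Y − Ω m(μD)J Y` of the skeleton (line-of-record
notation, `…Cruxes/SkeletonJ1R/Lines/streamline_kantorovich_R_L-notes.md`), the `L²` pairing on CLAMPED fields is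

  `∫⟪w•Y′ − S⊥Y, Y⟫ = −∫ (¾‖Y‖² + ⟪dev S⊥ Y, Y⟫)`      (transport by parts + trace identity `tr S⊥ = 3/2 − w′`),

the nonlocal self-induction being conservative (landed: `…Clause13RAdjointEnergy.setIntegral_inner_nonlocal_eq_zero`).
It is coercive iff the normal-strain DEVIATOR obeys `sup d < ¾`.  For two straight filaments with PERPENDICULAR tangents
and offsets along the common normal, the partner's strain has normal block `diag(−s_t, 0)` (`perp_normal_block`), so
`d(s) = |W′(s) − ½|/2` and coercivity is the slip-slope window `−1 < W′ < 2`, margin `1 − Λ/2` (`perp_margin`).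
The GP datum of record (`straightDatumGP_exists`, tangents at `acos(7/25)`) has `d = 0.889` at the waist and `8.4` at
closest approach (toy `toy/perp_datum.py`): the plain identity fails there; the perpendicular datum has `d ≤ 5/8`.
-/

noncomputable section

open scoped RealInnerProductSpace InnerProductSpace
open MeasureTheory intervalIntegral
open Summit.NavierStokesRegularity.NavierStokesRegularity.Theorems.FilamentSkeletonRssSkeletonJ1GSplit (StraightDatum)
open Summit.NavierStokesRegularity.NavierStokesRegularity.Theorems.Clause13RAdjointEnergy (integral_transport_eq)

namespace Summit.NavierStokesRegularity.NavierStokesRegularity.Cruxes.SkeletonJ1R.PerpendicularDatumCoercivity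
set_option linter.dupNamespace false

/-- (D) A PERPENDICULAR straight skew datum in the coercive slip window: two straight lines with orthogonal unit tangents,
offsets along their common normal, all `StraightDatum` clauses, and global slip-slope bound `Λ < 2` (so the normal-strain
deviator `|W′−½|/2` stays below `¾`).  Numerical witness (toy/perp_datum.py): `t = (±1,0,1)/√2`, `p = ±(D/2)e₂`,
`D = 0.5484`, `γ ≡ 125π/108`, `α = 3.266`, `s₀ ≡ D/√3`, `W′(s₀) = 7/4`, `sup|W′| = 7/4`, `mw = 1/12`; a rational witness
is `t = (3/5,0,4/5), (−4/5,0,3/5)`, `D = 1/2`, `s₀` rational near `D/√3`, `α` solved from `W(s₀) = 0`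
(`W(s) = s/2 + 3αD/10 − (γ/2π)·D/(D²+s²)`).  (route-posited statement of the idea; not a Literature fact) -/
def PerpStraightDatumExists : Prop :=
  ∃ (δ ρ Λ Rw θ₀ mw : ℝ) (p t : Fin 2 → EuclideanSpace ℝ (Fin 3)) (γ : Fin 2 → ℝ) (α : ℝ) (s₀ : Fin 2 → ℝ),
    0 < δ ∧ 0 < ρ ∧ 0 < Rw ∧ 0 < θ₀ ∧ 0 < mw ∧ Λ < 2 ∧ StraightDatum 2 δ ρ Λ Rw θ₀ mw p t γ α s₀ ∧
    ⟪t 0, t 1⟫_ℝ = 0 ∧ (∀ j, ⟪p 0 - p 1, t j⟫_ℝ = 0)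

/-- (A) POINTWISE ALGEBRA.  A trace-free symmetric strain supported in the plane `span{t, p}` (the velocity gradient of a
straight partner vortex with tangent `q ⊥ t, p`, outside its core) has, in the normal frame `(p, q)` of a filament with
tangent `t`, the block `diag(−s_tt, 0)`: its only normal eigenvalue is minus the stretching rate. [folklore] -/
theorem perp_normal_block (t p q : EuclideanSpace ℝ (Fin 3)) (ht : ‖t‖ = 1) (hp : ‖p‖ = 1)
    (htp : ⟪t, p⟫_ℝ = 0) (htq : ⟪t, q⟫_ℝ = 0) (hpq : ⟪p, q⟫_ℝ = 0) (stt stp : ℝ) :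
    let S : EuclideanSpace ℝ (Fin 3) → EuclideanSpace ℝ (Fin 3) :=
      fun y => stt • (⟪t, y⟫_ℝ • t - ⟪p, y⟫_ℝ • p) + stp • (⟪p, y⟫_ℝ • t + ⟪t, y⟫_ℝ • p)
    ⟪S t, t⟫_ℝ = stt ∧ ⟪S p, p⟫_ℝ = -stt ∧ ⟪S q, q⟫_ℝ = 0 ∧ ⟪S p, q⟫_ℝ = 0 ∧ ⟪S q, p⟫_ℝ = 0 := by
  intro S
  have htt : ⟪t, t⟫_ℝ = 1 := by rw [real_inner_self_eq_norm_sq, ht]; norm_num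
  have hpp : ⟪p, p⟫_ℝ = 1 := by rw [real_inner_self_eq_norm_sq, hp]; norm_num
  have hpt : ⟪p, t⟫_ℝ = 0 := by rw [real_inner_comm]; exact htp
  have hqt : ⟪q, t⟫_ℝ = 0 := by rw [real_inner_comm]; exact htq
  have hqp : ⟪q, p⟫_ℝ = 0 := by rw [real_inner_comm]; exact hpq
  simp only [S, inner_add_left, inner_sub_left, inner_smul_left, RCLike.conj_to_real, htt, hpp, htp, hpt, htq, hpq]
  refine ⟨?_, ?_, ?_, ?_, ?_⟩ <;> ring

/-- (A′) The coercivity MARGIN of a perpendicular datum: with normal block `diag(½ − s, ½)` (`s = W′ − ½` the stretching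
rate) the isotropic part is `(3/2 − W′)/2`, the deviator is `|W′ − ½|/2`, and `¾ − |W′−½|/2 > 0` exactly on the slip-slope
window `−1 < W′ < 2`; at the waist value `W′ = 7/4` of the toy datum the margin is `1/8`. [folklore] -/
theorem perp_margin (W' : ℝ) (hlo : -1 < W') (hhi : W' < 2) : 0 < 3 / 4 - |W' - 1 / 2| / 2 := by
  rcases le_or_gt 0 (W' - 1 / 2) with h | h
  · rw [abs_of_nonneg h]; linarith
  · rw [abs_of_neg h]; linarith

example : (3 : ℝ) / 4 - |7 / 4 - 1 / 2| / 2 = 1 / 8 := by norm_num [abs_of_pos]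

/-- (E) THE CLAMPED ENERGY INEQUALITY (first lemma of the line).  For a `C¹` slip `w`, a clamped `C¹` field `Y` on `[a,b]`
and a zeroth-order coefficient `S` whose quadratic form is bounded below by `((3/2 − w′)/2 − d)‖·‖²` (isotropic part from
the trace identity `tr S⊥ = 3/2 − w′`, minus the deviator `d`):
`∫⟪w•Y′ − S Y, Y⟫ ≤ −∫ (¾ − d)‖Y‖²`.  The conservative nonlocal term is added for free by
`…Clause13RAdjointEnergy.setIntegral_inner_nonlocal_eq_zero`. [folklore] (energy method; transport by parts) -/
theorem clamped_energy_le {a b : ℝ} (hab : a ≤ b) {w w' d : ℝ → ℝ}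
    {Y Y' SY : ℝ → EuclideanSpace ℝ (Fin 3)}
    (hw : ∀ σ, HasDerivAt w (w' σ) σ) (hY : ∀ σ, HasDerivAt Y (Y' σ) σ) (hw'c : Continuous w') (hY'c : Continuous Y')
    (hSc : Continuous SY) (hdc : Continuous d) (hYa : Y a = 0) (hYb : Y b = 0)
    (hS : ∀ σ, ((3 / 2 - w' σ) / 2 - d σ) * ‖Y σ‖ ^ 2 ≤ ⟪SY σ, Y σ⟫_ℝ) :
    ∫ σ in a..b, ⟪w σ • Y' σ - SY σ, Y σ⟫_ℝ ≤ -∫ σ in a..b, (3 / 4 - d σ) * ‖Y σ‖ ^ 2 := by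
  have hYc : Continuous Y := continuous_iff_continuousAt.2 fun σ => (hY σ).continuousAt
  have hwc : Continuous w := continuous_iff_continuousAt.2 fun σ => (hw σ).continuousAt
  -- pointwise bound by an integrand whose integral is computable
  have hpt : ∀ σ ∈ Set.Icc a b, ⟪w σ • Y' σ - SY σ, Y σ⟫_ℝ ≤
      -((3 / 4 - d σ) * ‖Y σ‖ ^ 2) + 1 / 2 * (w' σ * ‖Y σ‖ ^ 2 + 2 * w σ * ⟪Y' σ, Y σ⟫_ℝ) := by
    intro σ _
    have h1 : ⟪w σ • Y' σ - SY σ, Y σ⟫_ℝ = w σ * ⟪Y' σ, Y σ⟫_ℝ - ⟪SY σ, Y σ⟫_ℝ := by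
      rw [inner_sub_left, inner_smul_left, RCLike.conj_to_real]
    rw [h1]
    nlinarith [hS σ]
  have hi1 : IntervalIntegrable (fun σ => ⟪w σ • Y' σ - SY σ, Y σ⟫_ℝ) volume a b :=
    (((hwc.smul hY'c).sub hSc).inner hYc).intervalIntegrable a b
  have hA : Continuous fun σ => (3 / 4 - d σ) * ‖Y σ‖ ^ 2 :=
    (continuous_const.sub hdc).mul ((hYc.norm).pow 2)
  have hB : Continuous fun σ => w' σ * ‖Y σ‖ ^ 2 + 2 * w σ * ⟪Y' σ, Y σ⟫_ℝ :=
    (hw'c.mul ((hYc.norm).pow 2)).add ((continuous_const.mul hwc).mul (hY'c.inner hYc))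
  have hi2 : IntervalIntegrable
      (fun σ => -((3 / 4 - d σ) * ‖Y σ‖ ^ 2) + 1 / 2 * (w' σ * ‖Y σ‖ ^ 2 + 2 * w σ * ⟪Y' σ, Y σ⟫_ℝ)) volume a b :=
    (hA.neg.add (continuous_const.mul hB)).intervalIntegrable a b
  have hmono := intervalIntegral.integral_mono_on hab hi1 hi2 hpt
  have htr : ∫ σ in a..b, (w' σ * ‖Y σ‖ ^ 2 + 2 * w σ * ⟪Y' σ, Y σ⟫_ℝ) = 0 := by
    rw [integral_transport_eq hw hY hw'c hY'c, hYa, hYb]; simp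
  have h2a : IntervalIntegrable (fun σ => -((3 / 4 - d σ) * ‖Y σ‖ ^ 2)) volume a b :=
    show IntervalIntegrable (fun σ => -((3 / 4 - d σ) * ‖Y σ‖ ^ 2)) volume a b from hA.neg.intervalIntegrable a b
  have h2b : IntervalIntegrable (fun σ => 1 / 2 * (w' σ * ‖Y σ‖ ^ 2 + 2 * w σ * ⟪Y' σ, Y σ⟫_ℝ)) volume a b :=
    show IntervalIntegrable (fun σ => 1 / 2 * (w' σ * ‖Y σ‖ ^ 2 + 2 * w σ * ⟪Y' σ, Y σ⟫_ℝ)) volume a b from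
      (continuous_const.mul hB).intervalIntegrable a b
  have e1 : ∫ σ in a..b, (-((3 / 4 - d σ) * ‖Y σ‖ ^ 2) + 1 / 2 * (w' σ * ‖Y σ‖ ^ 2 + 2 * w σ * ⟪Y' σ, Y σ⟫_ℝ))
      = (∫ σ in a..b, -((3 / 4 - d σ) * ‖Y σ‖ ^ 2))
        + ∫ σ in a..b, 1 / 2 * (w' σ * ‖Y σ‖ ^ 2 + 2 * w σ * ⟪Y' σ, Y σ⟫_ℝ) :=
    intervalIntegral.integral_add h2a h2b
  have e2 : ∫ σ in a..b, -((3 / 4 - d σ) * ‖Y σ‖ ^ 2) = -∫ σ in a..b, (3 / 4 - d σ) * ‖Y σ‖ ^ 2 :=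
    intervalIntegral.integral_neg
  have e3 : ∫ σ in a..b, 1 / 2 * (w' σ * ‖Y σ‖ ^ 2 + 2 * w σ * ⟪Y' σ, Y σ⟫_ℝ)
      = 1 / 2 * ∫ σ in a..b, (w' σ * ‖Y σ‖ ^ 2 + 2 * w σ * ⟪Y' σ, Y σ⟫_ℝ) :=
    intervalIntegral.integral_const_mul _ _
  rw [e1, e2, e3, htr] at hmono
  linarith [hmono]

end Summit.NavierStokesRegularity.NavierStokesRegularity.Cruxes.SkeletonJ1R.PerpendicularDatumCoercivity
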